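import Summits.HodgeConjecture.HodgeConjecture.Theorems.R90S6MacdonaldRankOneU2   -- ★ W8-g′ (this seat): the N = 2 recursion in Hecke ∕ Satake ∕ eigenvalue form, `eq_basic_two`
import HarnessLib

/-!
# R90 · S6 — card F2′-U2: MACDONALD'S CLOSED FORM FOR THE UNRAMIFIED `U(1,1)` — `𝒮(φ_m) = q^m (x^m + x^{−m}) + (q − 1) q^{m−1} Σ_{|j|<m} x^j`
# on the `(q+1)`-regular tree (`q = √Q = q_v`, `x = x^{(1,−1)}`), the BALL formula `Σ_{i≤k} 𝒮(φ_i) = q^k Σ_{|j|≤k} x^j` and the INVERSE expansion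
# `q^m (x^m + x^{−m}) = 𝒮(φ_m) − (q − 1) Σ_{i<m} 𝒮(φ_i)` (`Theorems/R90S6MacdonaldClosedFormU2.lean`)

Cell `hodgecm-mathlib`, crux H413 (`stmt-HodgeConjecture-24833`), route of record `HCCMUnconditional`; programme R90-TF, section S6 (base `R90-C14`), seat
R90-C14-p03 (g2); sequel F2′-U2 «MACDONALD CLOSED FORM N = 2» of W8-g′ (dealer R90-C14-plan (g2), R90 bus 2026-09-05T00:11:33Z), DAG r5 row E1.3.2.1 «CLOSED-FORM
rank-one Satake transforms (Macdonald's formula …) on the `(q+1)`-regular tree of `U(2)_w`».  Helper lane `--supports stmt-HodgeConjecture-24833 --as helper`; THEOREMS ONLY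
(no definition, no instance, no notation, no named fact, no `sorry`); imports = ★ `Theorems.R90S6MacdonaldRankOneU2` + HarnessLib.

THE PRINT.  [Macdonald1971, Ch. V §3 (3.4)–(3.6)]; [ManteroZappa2011, Thm. 8.38 (homogeneous case)]; [SerreTrees1980, II.1.1]; [CartierCorvallis1979, §IV (4.2)–(4.4)]:
on the `(q+1)`-regular tree seen from a vertex `o` with stabiliser `K`, the spherical Hecke operators `φ_m = 1_{K tᵐ K}` (`tᵐ·o` at distance `2m` in the bipartite
Bruhat–Tits picture, distance `m` in the quotient tree of hyperspecial vertices) have Satake transforms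
`𝒮(φ_m) = q^m (x^m + x^{−m}) + (q − 1) q^{m−1} (x^{m−1} + x^{m−2} + ⋯ + x^{1−m})` (`m ≥ 1`), equivalently the BALL `Σ_{i=0}^{k} φ_i = 1_{B(o,k)}` transforms to
`q^k Σ_{|j|≤k} x^j` — the two roots of the recursion `𝒮(φ_{m+1}) = q(x + x⁻¹)𝒮(φ_m) − q²𝒮(φ_{m−1})` (★ W8-g′ `satakeTransform_doubleCosetOperator_mul_pow_two_succ`) being `qx`, `qx⁻¹`.
Here `Q = #𝓀[K] = q_v²`, `q = √Q = Nat.sqrt Q` (★ `sqrt_card_residueField_mul_self`: `q·q = Q` since `σ ≠ id`), and `x^j = x^{ℓ_j}`, `ℓ_j = (j, −j) : Fin 2 → ℤ`, in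
`ℂ[ℤ²] = AddMonoidAlgebra ℂ (Fin 2 → ℤ)`.

WHAT IS PROVED (`hd : UnramifiedLocalConjDatum σ ϖ`, `hσ : σ ≠ id`, `[Finite 𝓀[K]]`, `(U, K₀)` a Hecke pair as an instance binder, `t ∈ U(σ, antidiag(1,1))(K)` any element
with matrix `diag(ϖ, ϖ⁻¹)`, `φ_m = doubleCosetOperator K₀ (tᵐ)`; W-orbit sums `x^{ℓ_a} + x^{ℓ_{−a}}` and balls `1 + Σ_{k<n} (x^{ℓ_{k+1}} + x^{ℓ_{−(k+1)}})` written out):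
* §1 the algebra of `ℂ[ℤ²]` along the line `ℓ`: `single_line_two_mul` (`x^{ℓ_a} x^{ℓ_b} = x^{ℓ_{a+b}}`), `orbitSum_one_mul_orbitSum_two` (`(x + x⁻¹)(x^a + x^{−a}) = (x^{a+1} + x^{−(a+1)})
  + (x^{a−1} + x^{−(a−1)})`), `orbitSum_one_mul_ball_two` (`(x + x⁻¹)·B_{n+1} = B_{n+2} + B_n`);
* §2 **`satakeTransform_doubleCosetOperator_pow_two_eq`** — THE CLOSED FORM (`m ≥ 1`); **`sum_satakeTransform_doubleCosetOperator_pow_two`** — THE BALL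
  (`Σ_{i ≤ k} 𝒮(φ_i) = q^k · B_k`, all `k`); **`smul_orbitSum_eq_satakeTransform_sub_two`** — THE INVERSE EXPANSION `q^m (x^m + x^{−m}) = 𝒮(φ_m) − (q−1) Σ_{i<m} 𝒮(φ_i)`
  (`m ≥ 1`): every `W`-invariant Laurent polynomial is an explicit combination of the `𝒮(φ_i)`.
HONEST LABEL: local spherical Hecke-algebra bookkeeping; proves no printed global statement, discharges no citation; count-neutral helper until E1.3.2.1's consumers
(E1.3.5.2.5 `ξ̂_H(φ_m)` expansions on the `H = U(2) × U(1)` side, E1.4.4.2.3) use it.  HC_CM is proved only modulo the 7 printed citations (2 remaining named inputs: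
hLiu418 = stmt-HodgeConjecture-24832, h413 = stmt-HodgeConjecture-24833) until rung 0 closes; REL ≠ ★ ≠ BUILT.

## Tree search
★ this seat's `R90S6MacdonaldRankOneU2` (recursion, `eq_basic_two`); ★ `UnramifiedLocalConjDatum.satakeTransform_doubleCosetOperator_basic_two` (m = 1);
★ `UnramifiedLocalConjDatum.sqrt_card_residueField_mul_self` [UnramifiedTraceZeroLatticeIndex :297]; Mathlib `AddMonoidAlgebra.single_mul_single`, `AddMonoidAlgebra.one_def`,
`Finset.sum_range_succ`.  Dedup: `rg "ClosedFormU2|pow_two_eq|orbitSum_one_mul"` over `lean/` — no hit; ★ `K2LiuCartanSeriesU11Closed` is the scalar GENERATING-SERIES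
form of the eigenvalue recursion (hLiu418 #28i), not this.

## References
* [Macdonald1971] I. G. Macdonald, *Spherical functions on a group of p-adic type*, Ramanujan Inst. Publ. 2 (1971), Ch. V §3.
* [ManteroZappa2011] A. M. Mantero, A. Zappa, *Macdonald formula for spherical functions on affine buildings*, Ann. Fac. Sci. Toulouse (6) 20 (2011), Thm. 8.38.
* [CartierCorvallis1979] P. Cartier, *Representations of 𝔭-adic groups: a survey*, PSPM 33.1 (1979), §IV (4.2)–(4.4).
* [SerreTrees1980] J.-P. Serre, *Trees* (1980), II.1.1.
-/

set_option autoImplicit false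
-- the mandated namespace repeats the single-problem summit's segment (`HodgeConjecture.HodgeConjecture`)
set_option linter.dupNamespace false

noncomputable section

open scoped Valued WithZero Matrix MatrixGroups Pointwise
open MulAction ConjAct

namespace Summit.HodgeConjecture.HodgeConjecture.R90.S6

open Literature.NumberTheory.Automorphic Literature.NumberTheory.Automorphic.HermitianLattice
  Literature.NumberTheory.Automorphic.HermitianLattice.UnramifiedLocalConjDatum Literature.NumberTheory.Automorphic.CartanUnique
  Literature.NumberTheory.Automorphic.SymplecticCartan Literature.NumberTheory.Automorphic.heckeAlgebra

/-! ## §1 The algebra of `ℂ[ℤ²]` along the line `ℓ_a = (a, −a)` -/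

section Line

/-- `ℓ_a + ℓ_b = ℓ_{a+b}`. [folklore] -/
theorem line_two_add (a b : ℤ) :
    ((fun i : Fin 2 => a * (1 - 2 * (i : ℕ))) + fun i : Fin 2 => b * (1 - 2 * (i : ℕ))) = fun i : Fin 2 => (a + b) * (1 - 2 * (i : ℕ)) := by
  funext i
  simp only [Pi.add_apply]
  ring

/-- `ℓ_0 = 0`. [folklore] -/
theorem line_two_zero : (fun i : Fin 2 => (0 : ℤ) * (1 - 2 * (i : ℕ))) = 0 := by
  funext i
  simp

/-- **`x^{ℓ_a} · x^{ℓ_b} = x^{ℓ_{a+b}}`** in `ℂ[ℤ²]`. [cite: CartierCorvallis1979, §IV (4.2)] -/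
theorem single_line_two_mul (a b : ℤ) :
    AddMonoidAlgebra.single (fun i : Fin 2 => a * (1 - 2 * (i : ℕ))) (1 : ℂ) * AddMonoidAlgebra.single (fun i : Fin 2 => b * (1 - 2 * (i : ℕ))) (1 : ℂ) =
      AddMonoidAlgebra.single (fun i : Fin 2 => (a + b) * (1 - 2 * (i : ℕ))) (1 : ℂ) := by
  rw [AddMonoidAlgebra.single_mul_single, line_two_add, mul_one]

/-- `x^{ℓ_0} = 1`. [folklore] -/
theorem single_line_two_zero : AddMonoidAlgebra.single (fun i : Fin 2 => (0 : ℤ) * (1 - 2 * (i : ℕ))) (1 : ℂ) = 1 := by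
  rw [line_two_zero, AddMonoidAlgebra.one_def]

/-- **Chebyshev step for the `W`-orbit sums**: `(x + x⁻¹)·(x^a + x^{−a}) = (x^{a+1} + x^{−(a+1)}) + (x^{a−1} + x^{−(a−1)})`. [cite: Macdonald1971, Ch. V §3] -/
theorem orbitSum_one_mul_orbitSum_two (a : ℤ) :
    (AddMonoidAlgebra.single (fun i : Fin 2 => (1 : ℤ) * (1 - 2 * (i : ℕ))) (1 : ℂ) +
        AddMonoidAlgebra.single (fun i : Fin 2 => (-1 : ℤ) * (1 - 2 * (i : ℕ))) (1 : ℂ)) *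
      (AddMonoidAlgebra.single (fun i : Fin 2 => a * (1 - 2 * (i : ℕ))) (1 : ℂ) +
        AddMonoidAlgebra.single (fun i : Fin 2 => (-a) * (1 - 2 * (i : ℕ))) (1 : ℂ)) =
      (AddMonoidAlgebra.single (fun i : Fin 2 => (a + 1) * (1 - 2 * (i : ℕ))) (1 : ℂ) +
        AddMonoidAlgebra.single (fun i : Fin 2 => (-(a + 1)) * (1 - 2 * (i : ℕ))) (1 : ℂ)) +
      (AddMonoidAlgebra.single (fun i : Fin 2 => (a - 1) * (1 - 2 * (i : ℕ))) (1 : ℂ) +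
        AddMonoidAlgebra.single (fun i : Fin 2 => (-(a - 1)) * (1 - 2 * (i : ℕ))) (1 : ℂ)) := by
  rw [add_mul, mul_add, mul_add, single_line_two_mul, single_line_two_mul, single_line_two_mul, single_line_two_mul,
    show (1 : ℤ) + a = a + 1 by ring, show (1 : ℤ) + -a = -(a - 1) by ring, show (-1 : ℤ) + a = a - 1 by ring,
    show (-1 : ℤ) + -a = -(a + 1) by ring]
  abel

/-- **Chebyshev step for the BALLS** `B_n = 1 + Σ_{k<n} (x^{k+1} + x^{−(k+1)}) = Σ_{|j| ≤ n} x^j`: `(x + x⁻¹)·B_{n+1} = B_{n+2} + B_n`. [cite: Macdonald1971, Ch. V §3] -/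
theorem orbitSum_one_mul_ball_two (n : ℕ) :
    (AddMonoidAlgebra.single (fun i : Fin 2 => (1 : ℤ) * (1 - 2 * (i : ℕ))) (1 : ℂ) +
        AddMonoidAlgebra.single (fun i : Fin 2 => (-1 : ℤ) * (1 - 2 * (i : ℕ))) (1 : ℂ)) *
      (1 + ∑ k ∈ Finset.range (n + 1), (AddMonoidAlgebra.single (fun i : Fin 2 => ((k : ℤ) + 1) * (1 - 2 * (i : ℕ))) (1 : ℂ) +
        AddMonoidAlgebra.single (fun i : Fin 2 => (-((k : ℤ) + 1)) * (1 - 2 * (i : ℕ))) (1 : ℂ))) =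
      (1 + ∑ k ∈ Finset.range (n + 2), (AddMonoidAlgebra.single (fun i : Fin 2 => ((k : ℤ) + 1) * (1 - 2 * (i : ℕ))) (1 : ℂ) +
        AddMonoidAlgebra.single (fun i : Fin 2 => (-((k : ℤ) + 1)) * (1 - 2 * (i : ℕ))) (1 : ℂ))) +
      (1 + ∑ k ∈ Finset.range n, (AddMonoidAlgebra.single (fun i : Fin 2 => ((k : ℤ) + 1) * (1 - 2 * (i : ℕ))) (1 : ℂ) +
        AddMonoidAlgebra.single (fun i : Fin 2 => (-((k : ℤ) + 1)) * (1 - 2 * (i : ℕ))) (1 : ℂ))) := by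
  induction n with
  | zero =>
    -- `(x + x⁻¹)(1 + (x + x⁻¹)) = (x + x⁻¹) + (x² + x⁻²) + 2 = B₂ + B₀`
    rw [Finset.sum_range_one, Finset.sum_range_succ, Finset.sum_range_one, Finset.sum_range_zero, add_zero, Nat.cast_zero, zero_add,
      Nat.cast_one, mul_add, mul_one, show (-(1 : ℤ)) = (-1 : ℤ) from rfl, orbitSum_one_mul_orbitSum_two 1,
      show (1 : ℤ) - 1 = 0 by ring, neg_zero, single_line_two_zero]
    abel
  | succ n ih =>
    rw [Finset.sum_range_succ _ (n + 1), ← add_assoc, mul_add, ih, Finset.sum_range_succ _ (n + 2), Finset.sum_range_succ _ n,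
      orbitSum_one_mul_orbitSum_two]
    push_cast
    rw [show (n : ℤ) + 1 + 1 - 1 = (n : ℤ) + 1 by ring, show (n : ℤ) + 1 + 1 + 1 = (n : ℤ) + 2 + 1 by ring]
    abel

end Line

/-! ## §2 The closed form, the ball formula and the inverse expansion -/

section Closed

/-- Light-carrier bookkeeping: an algebra hom applied to a product formula `x * y = z + a • w + b • v`. [folklore] -/
private theorem algHom_mul_of_eq {R A B : Type*} [CommSemiring R] [Semiring A] [Semiring B] [Algebra R A] [Algebra R B]
    (f : A →ₐ[R] B) {x y z w v : A} {a b : R} (h : x * y = z + a • w + b • v) : f x * f y = f z + a • f w + b • f v := by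
  rw [← map_mul, h, map_add, map_add, map_smul, map_smul]

/-- Light-carrier bookkeeping: an algebra hom applied to a square formula `x * x = z + a • x + b • 1`. [folklore] -/
private theorem algHom_mul_self_of_eq {R A B : Type*} [CommSemiring R] [Semiring A] [Semiring B] [Algebra R A] [Algebra R B]
    (f : A →ₐ[R] B) {x z : A} {a b : R} (h : x * x = z + a • x + b • 1) : f x * f x = f z + a • f x + b • 1 := by
  rw [← map_mul, h, map_add, map_add, map_smul, map_smul, map_one]

variable {K : Type*} [Field K] [Valued K ℤᵐ⁰] {σ : K →+* K} {ϖ : K} [Finite 𝓀[K]]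

/-- `Q = q · q` for the natural-number casts into any semiring (`q = Nat.sqrt Q`; `σ ≠ id`, ★ `sqrt_card_residueField_mul_self`). [cite: SerreTrees1980, II.1.1] -/
theorem natCast_card_residueField_eq_sqrt_mul_sqrt {R : Type*} [Semiring R] (hd : UnramifiedLocalConjDatum σ ϖ) (hσ : ∃ x : K, σ x ≠ x) :
    ((Nat.card 𝓀[K] : ℕ) : R) = (Nat.sqrt (Nat.card 𝓀[K]) : R) * (Nat.sqrt (Nat.card 𝓀[K]) : R) := by
  rw [← Nat.cast_mul, hd.sqrt_card_residueField_mul_self hσ]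

variable [IsHeckeTriple (⊤ : Submonoid (unitaryGroupOfForm σ ((StdForm.antidiagonal 2).over K))) (unitaryInt σ ((StdForm.antidiagonal 2).over K))
    (unitaryInt σ ((StdForm.antidiagonal 2).over K))]

/-- THE CLOSED FORM in successor indexing: `𝒮(φ_{n+1}) = q^{n+1}(x^{n+1} + x^{−(n+1)}) + (q−1) qⁿ B_n`, by two-step induction on `n` from `m = 1` (★ `…_basic_two`),
`m = 2` (★ `doubleCosetOperator_mul_self_two` through `𝒮`) and the recursion ★ `satakeTransform_doubleCosetOperator_mul_pow_two_succ`. [cite: Macdonald1971, Ch. V §3] -/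
theorem satakeTransform_doubleCosetOperator_pow_succ_two_eq (hd : UnramifiedLocalConjDatum σ ϖ) (hσ : ∃ x : K, σ x ≠ x)
    (t : unitaryGroupOfForm σ ((StdForm.antidiagonal 2).over K)) (ht : (t : GL (Fin 2) K) = zpowDiagGL (uniformizer_ne_zero hd.vϖ) ![(1 : ℤ), -1])
    (n : ℕ) :
    hd.satakeTransform (doubleCosetOperator (unitaryInt σ ((StdForm.antidiagonal 2).over K)) (t ^ (n + 1))) =
      ((Nat.sqrt (Nat.card 𝓀[K]) : ℂ) ^ (n + 1)) •
          (AddMonoidAlgebra.single (fun i : Fin 2 => ((n : ℤ) + 1) * (1 - 2 * (i : ℕ))) (1 : ℂ) +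
            AddMonoidAlgebra.single (fun i : Fin 2 => (-((n : ℤ) + 1)) * (1 - 2 * (i : ℕ))) (1 : ℂ)) +
        (((Nat.sqrt (Nat.card 𝓀[K]) : ℂ) - 1) * (Nat.sqrt (Nat.card 𝓀[K]) : ℂ) ^ n) •
          (1 + ∑ k ∈ Finset.range n, (AddMonoidAlgebra.single (fun i : Fin 2 => ((k : ℤ) + 1) * (1 - 2 * (i : ℕ))) (1 : ℂ) +
            AddMonoidAlgebra.single (fun i : Fin 2 => (-((k : ℤ) + 1)) * (1 - 2 * (i : ℕ))) (1 : ℂ))) := by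
  -- `Q = q²` read in `ℂ[ℤ²]`
  have hQA : ((Nat.card 𝓀[K] : ℕ) : AddMonoidAlgebra ℂ (Fin 2 → ℤ)) =
      (Nat.sqrt (Nat.card 𝓀[K]) : AddMonoidAlgebra ℂ (Fin 2 → ℤ)) * (Nat.sqrt (Nat.card 𝓀[K]) : AddMonoidAlgebra ℂ (Fin 2 → ℤ)) :=
    natCast_card_residueField_eq_sqrt_mul_sqrt hd hσ
  -- `(x + x⁻¹)² = (x² + x⁻²) + 2`
  have hx : (AddMonoidAlgebra.single (fun i : Fin 2 => (1 : ℤ) * (1 - 2 * (i : ℕ))) (1 : ℂ) +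
        AddMonoidAlgebra.single (fun i : Fin 2 => (-1 : ℤ) * (1 - 2 * (i : ℕ))) (1 : ℂ)) *
      (AddMonoidAlgebra.single (fun i : Fin 2 => (1 : ℤ) * (1 - 2 * (i : ℕ))) (1 : ℂ) +
        AddMonoidAlgebra.single (fun i : Fin 2 => (-1 : ℤ) * (1 - 2 * (i : ℕ))) (1 : ℂ)) =
      (AddMonoidAlgebra.single (fun i : Fin 2 => ((1 : ℤ) + 1) * (1 - 2 * (i : ℕ))) (1 : ℂ) +
        AddMonoidAlgebra.single (fun i : Fin 2 => (-((1 : ℤ) + 1)) * (1 - 2 * (i : ℕ))) (1 : ℂ)) + (1 + 1) := by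
    rw [show (-1 : ℤ) = -(1 : ℤ) from rfl, orbitSum_one_mul_orbitSum_two 1, show (1 : ℤ) - 1 = 0 by ring, neg_zero, single_line_two_zero]
  induction n using Nat.twoStepInduction with
  | zero =>
    -- `m = 1`: ★ `satakeTransform_doubleCosetOperator_basic_two`
    rw [Nat.cast_zero, zero_add, zero_add, pow_one, pow_one, pow_zero, mul_one, Finset.sum_range_zero, add_zero,
      eq_basic_two hd t ht, hd.satakeTransform_doubleCosetOperator_basic_two hσ, Algebra.algebraMap_eq_smul_one]
  | one =>
    -- `m = 2`: `𝒮(φ₂) = 𝒮(φ₁)² − (q−1)𝒮(φ₁) − (Q + q)`, `𝒮(φ₁) = q(x + x⁻¹) + (q − 1)`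
    have hsq := algHom_mul_self_of_eq hd.satakeTransform (doubleCosetOperator_mul_self_two (k := ℂ) hd hσ t ht)
    rw [eq_basic_two hd t ht, hd.satakeTransform_doubleCosetOperator_basic_two hσ, ← eq_basic_two hd t ht] at hsq
    have hc1 : (((Nat.sqrt (Nat.card 𝓀[K]) - 1 : ℕ) : ℂ)) = (Nat.sqrt (Nat.card 𝓀[K]) : ℂ) - 1 := by
      haveI : Nonempty 𝓀[K] := ⟨0⟩
      rw [Nat.cast_sub (Nat.succ_le_of_lt (Nat.sqrt_pos.2 Nat.card_pos)), Nat.cast_one]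
    rw [hc1] at hsq
    rw [Algebra.algebraMap_eq_smul_one] at hsq
    rw [Finset.sum_range_one, pow_one, Nat.cast_zero, zero_add, Nat.cast_one, show (1 : ℕ) + 1 = 2 from rfl]
    simp only [one_mul, neg_mul] at hsq hx ⊢
    simp only [Algebra.smul_def, map_sub, map_one, map_add, map_natCast, map_mul, map_pow, Nat.cast_add, mul_one] at hsq ⊢
    rw [hQA] at hsq
    linear_combination -hsq + ((Nat.sqrt (Nat.card 𝓀[K]) : AddMonoidAlgebra ℂ (Fin 2 → ℤ)) *
      (Nat.sqrt (Nat.card 𝓀[K]) : AddMonoidAlgebra ℂ (Fin 2 → ℤ))) * hx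
  | more n ihn ihn1 =>
    have hrec := satakeTransform_doubleCosetOperator_mul_pow_two_succ hd hσ t ht (m := n + 2) (by omega)
    rw [show n + 2 - 1 = n + 1 from rfl, ihn1, ihn] at hrec
    rw [show n + 2 + 1 = n + 3 from rfl] at hrec ⊢
    rw [hrec]
    -- the two Chebyshev steps
    have hK1 := orbitSum_one_mul_orbitSum_two ((n : ℤ) + 2)
    rw [show (n : ℤ) + 2 - 1 = (n : ℤ) + 1 by ring] at hK1
    have hK2 := orbitSum_one_mul_ball_two n
    push_cast
    rw [show (n : ℤ) + 1 + 1 = (n : ℤ) + 2 by ring]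
    simp only [one_mul, neg_mul] at hK1 hK2 ⊢
    simp only [Algebra.smul_def, map_sub, map_one, map_natCast, map_mul, map_pow] at ⊢
    linear_combination ((Nat.sqrt (Nat.card 𝓀[K]) : AddMonoidAlgebra ℂ (Fin 2 → ℤ)) ^ (n + 3)) * hK1 +
      (((Nat.sqrt (Nat.card 𝓀[K]) : AddMonoidAlgebra ℂ (Fin 2 → ℤ)) - 1) * (Nat.sqrt (Nat.card 𝓀[K]) : AddMonoidAlgebra ℂ (Fin 2 → ℤ)) ^ (n + 2)) * hK2 -
      ((Nat.sqrt (Nat.card 𝓀[K]) : AddMonoidAlgebra ℂ (Fin 2 → ℤ)) ^ (n + 1) *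
          (AddMonoidAlgebra.single (fun i : Fin 2 => ((n : ℤ) + 1) * (1 - 2 * (i : ℕ))) (1 : ℂ) +
            AddMonoidAlgebra.single (fun i : Fin 2 => -(((n : ℤ) + 1) * (1 - 2 * (i : ℕ)))) (1 : ℂ)) +
        ((Nat.sqrt (Nat.card 𝓀[K]) : AddMonoidAlgebra ℂ (Fin 2 → ℤ)) - 1) * (Nat.sqrt (Nat.card 𝓀[K]) : AddMonoidAlgebra ℂ (Fin 2 → ℤ)) ^ n *
          (1 + ∑ k ∈ Finset.range n, (AddMonoidAlgebra.single (fun i : Fin 2 => ((k : ℤ) + 1) * (1 - 2 * (i : ℕ))) (1 : ℂ) +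
            AddMonoidAlgebra.single (fun i : Fin 2 => -(((k : ℤ) + 1) * (1 - 2 * (i : ℕ)))) (1 : ℂ)))) * hQA

/-- **MACDONALD'S CLOSED FORM FOR THE UNRAMIFIED `U(1,1)`** (`m ≥ 1`): in `ℂ[ℤ²]`,
`𝒮(φ_m) = q^m · (x^{ℓ_m} + x^{ℓ_{−m}}) + (q − 1) q^{m−1} · (1 + Σ_{k < m−1} (x^{ℓ_{k+1}} + x^{ℓ_{−(k+1)}}))` — `q = √Q = q_v`, the second factor being the ball
`Σ_{|j| ≤ m−1} x^{ℓ_j}`; the explicit `W`-invariant Laurent polynomial of DAG row E1.3.2.1 on the `(q_v + 1)`-regular tree. [cite: Macdonald1971, Ch. V §3]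
[cite: ManteroZappa2011, Thm. 8.38] [cite: CartierCorvallis1979, §IV (4.2), Thm. 4.1] -/
theorem satakeTransform_doubleCosetOperator_pow_two_eq (hd : UnramifiedLocalConjDatum σ ϖ) (hσ : ∃ x : K, σ x ≠ x)
    (t : unitaryGroupOfForm σ ((StdForm.antidiagonal 2).over K)) (ht : (t : GL (Fin 2) K) = zpowDiagGL (uniformizer_ne_zero hd.vϖ) ![(1 : ℤ), -1])
    {m : ℕ} (hm : 1 ≤ m) :
    hd.satakeTransform (doubleCosetOperator (unitaryInt σ ((StdForm.antidiagonal 2).over K)) (t ^ m)) =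
      ((Nat.sqrt (Nat.card 𝓀[K]) : ℂ) ^ m) •
          (AddMonoidAlgebra.single (fun i : Fin 2 => (m : ℤ) * (1 - 2 * (i : ℕ))) (1 : ℂ) +
            AddMonoidAlgebra.single (fun i : Fin 2 => (-(m : ℤ)) * (1 - 2 * (i : ℕ))) (1 : ℂ)) +
        (((Nat.sqrt (Nat.card 𝓀[K]) : ℂ) - 1) * (Nat.sqrt (Nat.card 𝓀[K]) : ℂ) ^ (m - 1)) •
          (1 + ∑ k ∈ Finset.range (m - 1), (AddMonoidAlgebra.single (fun i : Fin 2 => ((k : ℤ) + 1) * (1 - 2 * (i : ℕ))) (1 : ℂ) +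
            AddMonoidAlgebra.single (fun i : Fin 2 => (-((k : ℤ) + 1)) * (1 - 2 * (i : ℕ))) (1 : ℂ))) := by
  obtain ⟨n, rfl⟩ := Nat.exists_eq_add_of_le' hm
  rw [Nat.add_sub_cancel, Nat.cast_succ]
  exact satakeTransform_doubleCosetOperator_pow_succ_two_eq hd hσ t ht n

/-- **THE BALL FORMULA**: `Σ_{i=0}^{k} 𝒮(φ_i) = q^k · (1 + Σ_{j<k} (x^{ℓ_{j+1}} + x^{ℓ_{−(j+1)}})) = q^k · Σ_{|j| ≤ k} x^{ℓ_j}` — the Satake transform of the indicator of the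
ball of radius `k` about the base vertex of the `(q_v+1)`-regular tree (`φ_0 + ⋯ + φ_k`). [cite: Macdonald1971, Ch. V §3] [cite: SerreTrees1980, II.1.1] -/
theorem sum_satakeTransform_doubleCosetOperator_pow_two (hd : UnramifiedLocalConjDatum σ ϖ) (hσ : ∃ x : K, σ x ≠ x)
    (t : unitaryGroupOfForm σ ((StdForm.antidiagonal 2).over K)) (ht : (t : GL (Fin 2) K) = zpowDiagGL (uniformizer_ne_zero hd.vϖ) ![(1 : ℤ), -1])
    (k : ℕ) :
    ∑ i ∈ Finset.range (k + 1), hd.satakeTransform (doubleCosetOperator (unitaryInt σ ((StdForm.antidiagonal 2).over K)) (t ^ i)) =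
      ((Nat.sqrt (Nat.card 𝓀[K]) : ℂ) ^ k) •
        (1 + ∑ j ∈ Finset.range k, (AddMonoidAlgebra.single (fun i : Fin 2 => ((j : ℤ) + 1) * (1 - 2 * (i : ℕ))) (1 : ℂ) +
          AddMonoidAlgebra.single (fun i : Fin 2 => (-((j : ℤ) + 1)) * (1 - 2 * (i : ℕ))) (1 : ℂ))) := by
  induction k with
  | zero =>
    rw [Finset.sum_range_one, pow_zero, doubleCosetOperator_one, map_one, pow_zero, one_smul, Finset.sum_range_zero, add_zero]
  | succ k ih =>
    rw [Finset.sum_range_succ, ih, satakeTransform_doubleCosetOperator_pow_succ_two_eq hd hσ t ht k, Finset.sum_range_succ _ k]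
    simp only [Algebra.smul_def, map_sub, map_one, map_mul, map_pow]
    ring

/-- **THE INVERSE EXPANSION** (`m ≥ 1`): `q^m · (x^{ℓ_m} + x^{ℓ_{−m}}) = 𝒮(φ_m) − (q − 1) · Σ_{i<m} 𝒮(φ_i)` — every `W`-orbit sum, hence every `W`-invariant Laurent
polynomial in `ℂ[ℤ²]^W`, is an EXPLICIT combination of the Satake transforms `𝒮(φ_i)` (the coefficients by which E1.3.5.2.5 expands `ξ̂_H(φ_m)` in the `U(1,1)` Hecke basis).
[cite: Macdonald1971, Ch. V §3] [cite: CartierCorvallis1979, §IV Thm. 4.1] -/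
theorem smul_orbitSum_eq_satakeTransform_sub_two (hd : UnramifiedLocalConjDatum σ ϖ) (hσ : ∃ x : K, σ x ≠ x)
    (t : unitaryGroupOfForm σ ((StdForm.antidiagonal 2).over K)) (ht : (t : GL (Fin 2) K) = zpowDiagGL (uniformizer_ne_zero hd.vϖ) ![(1 : ℤ), -1])
    {m : ℕ} (hm : 1 ≤ m) :
    ((Nat.sqrt (Nat.card 𝓀[K]) : ℂ) ^ m) •
        (AddMonoidAlgebra.single (fun i : Fin 2 => (m : ℤ) * (1 - 2 * (i : ℕ))) (1 : ℂ) +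
          AddMonoidAlgebra.single (fun i : Fin 2 => (-(m : ℤ)) * (1 - 2 * (i : ℕ))) (1 : ℂ)) =
      hd.satakeTransform (doubleCosetOperator (unitaryInt σ ((StdForm.antidiagonal 2).over K)) (t ^ m)) -
        ((Nat.sqrt (Nat.card 𝓀[K]) : ℂ) - 1) •
          ∑ i ∈ Finset.range m, hd.satakeTransform (doubleCosetOperator (unitaryInt σ ((StdForm.antidiagonal 2).over K)) (t ^ i)) := by
  obtain ⟨n, rfl⟩ := Nat.exists_eq_add_of_le' hm
  rw [sum_satakeTransform_doubleCosetOperator_pow_two hd hσ t ht n, satakeTransform_doubleCosetOperator_pow_succ_two_eq hd hσ t ht n, Nat.cast_succ]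
  simp only [Algebra.smul_def, map_sub, map_one, map_mul, map_pow]
  ring

end Closed

end Summit.HodgeConjecture.HodgeConjecture.R90.S6

end
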